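import Summits.QuantumFields.YangMills.Theorems.AllWindowsColdBoxBulkMidHarmonicMaxPrincipleFluxDefs
import Summits.QuantumFields.YangMills.Theorems.ColdBoxAllGroupsOneScaleDefs

/-!
# LINE-18 «BulkMidWindowSU2 birth v5», stub S4 `stub_potentialCorollaries`: the three remaining Props of its signature, VERBATIM from the
# registered skeleton (planner ym-idea-2 g14, sha16 `3c750a3750a2f49e`), crux ⟨stmt-QuantumFields-24006⟩

The registered stub S4 of LINE-18 v5 is
`stub_potentialCorollaries : (DirKernelDipoleDecay → DirFreeVarLinear → DirResponseL1) ∧ (DirHarmonicMaxPrincipleFlux → KernelLargeFieldRarityFlatG)`.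
Of its five Props, `DirKernelDipoleDecay` (K1, file `…BulkMidKernelDipoleOfLandau`) and `DirHarmonicMaxPrincipleFlux` (K3′, file
`…BulkMidHarmonicMaxPrincipleFluxDefs`) are already in the by-name namespace `…Theorems.AllWindowsColdBoxBulkMidLine`; following the same
precedent this file copies the other three VERBATIM (same names, same bodies):

* `DirFreeVarLinear` — obligation C of LINE-17 (perimeter law of the free forest-gauge field, `Var(s_e) ≤ c·H`); it enters S4 only as an
  (unused) hypothesis of half 1;
* `DirResponseL1` — obligation K2: the ℓ¹ response of a deep `(1,2)`-plaquette circulation to the free link variables is `≤ c·H·(1+log H)²`;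
* `KernelLargeFieldRarityFlatG` — obligation R (v5): small-field rarity under the box kernel with a crude-good datum at the FLAT rate
  `ε > 2θ + δ` (`SU(2)`, `0 < θ ≤ 1/16`, `0 ≤ δ ≤ θ`), eventually in `β`.

Definitions only.  HONEST LABEL: no stub, crux, rung or summit is proved here; the Yang–Mills mass gap is NOT proved by this file.
-/

set_option autoImplicit false

noncomputable section

open MeasureTheory
open Literature.MathematicalPhysics.QuantumLattice
open Literature.MathematicalPhysics.QuantumFieldTheory
open Literature.MathematicalPhysics.QuantumFieldTheory.LatticeMaxwell
open Summit.QuantumFields.YangMills.Theorems.WeakCouplingRates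
open Summit.QuantumFields.YangMills.Theorems.ColdBoxAllGroups

namespace Summit.QuantumFields.YangMills.Theorems.AllWindowsColdBoxBulkMidLine

/-- **Obligation C of LINE-17 (verbatim from the LINE-18 skeleton v5)**: the perimeter law of the free forest-gauge field, `Var(s_e) ≤ c·H`
for every free edge `e` of the Dirichlet problem of the cold box. -/
def DirFreeVarLinear : Prop :=
  ∃ c : ℝ, 0 < c ∧ ∀ H : ℕ, 1 ≤ H → ∀ e : DirFree H,
    ∫ s, (WithLp.ofLp s e) ^ 2 ∂(boxDirichlet H) ≤ c * H

/-- **Obligation K2 of LINE-18 (verbatim from the skeleton v5): the response of a deep plaquette to link sources is ℓ¹-small** —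
`Σ_e |E_{boxDirichlet H}(dirCirc_x · s_e)| ≤ c·H·(1 + log H)²` for the deep `(1,2)`-plaquettes `x` (within `H/8` of the centre). -/
def DirResponseL1 : Prop :=
  ∃ c : ℝ, 0 < c ∧ ∀ H : ℕ, 1 ≤ H → ∀ x : Literature.Probability.LatticeModels.Site 4,
    (∀ m : Fin 4, 8 * |x m - (H : ℤ)| ≤ (H : ℤ)) →
      ∑ e : DirFree H, |∫ s, dirCirc H (x, 1, 2) s * WithLp.ofLp s e ∂(boxDirichlet H)| ≤
        c * (H : ℝ) * (1 + Real.log H) ^ 2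

/-- **Obligation R of LINE-18 v5 (verbatim from the skeleton): small-field rarity under the kernel at the FLAT rate.**  For `SU(2)`
(fundamental), box `H = ⌈β^θ⌉`, `0 < θ ≤ 1/16`, `0 ≤ δ ≤ θ` and `ε > 2θ + δ`, eventually in `β`, uniformly over crude-good data `ω`:
`γ((coldGoodSetG)ᶜ | ω) ≤ e^{−β^ε}`.  (The tree's B5-G `ColdBoxAllGroups.boxKernelG_real_coldGoodSetG_compl_le` is the range `ε > 3θ + δ`.) -/
def KernelLargeFieldRarityFlatG : Prop :=
  ∀ θ δ ε : ℝ, 0 < θ → θ ≤ 1 / 16 → 0 ≤ δ → δ ≤ θ → 2 * θ + δ < ε →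
    ∃ β₀ : ℝ, ∀ β : ℝ, β₀ ≤ β → ∀ ω : LGConfig 4 (Matrix.specialUnitaryGroup (Fin 2) ℂ),
      CrudeGoodG (fundamentalRep (Fin 2)) β δ ⌈β ^ θ⌉₊ ω →
        (boxKernelG (fundamentalRep (Fin 2)) β ⌈β ^ θ⌉₊ ω).real
            (coldGoodSetG (fundamentalRep (Fin 2)) ⌈β ^ θ⌉₊ β ε)ᶜ ≤ Real.exp (-(β ^ ε))

end Summit.QuantumFields.YangMills.Theorems.AllWindowsColdBoxBulkMidLine

end
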